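import Literature.NumberTheory.EllipticCurves.WeilPairingProofs
import Literature.NumberTheory.EllipticCurves.Sha
import Literature.NumberTheory.EllipticCurves.VariableChangePointsMap
import HarnessLib

/-!
# The cyclotomic line of an ordinary prime via the Weil pairing

`Proofs` file (theorems only) in topic `NumberTheory/EllipticCurves`; part of the local input
(brick B) of the elementary proof of Greenberg's Lemma 3.4 at the layer `n = 0` (LNM 1716, p. 89).
If `P₀ ∈ E(K̄_v)` has order `p^k`, a set `S` of Galois elements acts on `P₀` by scalars, and every
`σ ∈ S` moves each `p^k`-torsion point by a multiple of `P₀` (i.e. acts trivially on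
`E[p^k]/ℤP₀`), then there is a primitive `p^k`-th root of unity `ζ` on which every `σ ∈ S` acts
by the same exponent as on `P₀` (`localPoints_exists_isPrimitiveRoot_smul_eq_pow`): `ζ = e(Q, P₀)`
for the Weil pairing `e = e_{p^k}` and a suitable `Q` (non-degeneracy), and
`σζ = e(σQ, σP₀) = e(Q + dP₀, cP₀) = ζ^c` (bilinearity, `e(P₀, P₀) = 1`, Galois equivariance) —
Silverman's `det ρ_{E,p^k} = χ_{p^k}` (Cornell–Silverman–Stevens II §8) on the ordinary line.
This is hypothesis `hN'` of `exists_finset_cocycle_reps_of_cyclotomicLine`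
(`CyclotomicLineCocycleCountProofs`).

## References

* [SilvermanAEC2009] J. H. Silverman, *The Arithmetic of Elliptic Curves*, Prop. III.8.1.
* [SilvermanCSS1997] J. H. Silverman, in Cornell–Silverman–Stevens (1997), Ch. II §§7–8.
* [GreenbergLNM1716] R. Greenberg, LNM 1716 (1999), §2 p. 70 (the action on `ℱ[p^∞]` is `φψ⁻¹`).
-/

noncomputable section

open scoped Classical

universe u

namespace WeierstrassCurve

open Literature.NumberTheory.EllipticCurves Field

variable {K : Type u} [Field K] (W : WeierstrassCurve K) [W.IsElliptic]
  (E : Type u) [Field E] [Algebra K E] [CharZero E]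

omit [W.IsElliptic] [CharZero E] in
/-- `E(K̄_E)` (the tree's `localPoints W E`, points of `W ⊗ K̄_E`) is the group of geometric points
of `W ⊗ E` (points of `(W ⊗ E) ⊗ K̄_E`): the transport along `(W ⊗ E) ⊗ K̄_E = W ⊗ K̄_E`.
[folklore] -/
theorem baseChange_baseChange_algebraicClosure_eq :
    (W.baseChange E).baseChange (AlgebraicClosure E) = W.baseChange (AlgebraicClosure E) :=
  (W.map_baseChange (IsScalarTower.toAlgHom K E (AlgebraicClosure E)) : _)

/-- **The cyclotomic line via the Weil pairing.** Let `P₀ ∈ E(K̄_E)` have order `p^k`, and let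
`S ⊆ Γ_E` act on `P₀` by scalars `c(σ)` and on `E[p^k]/ℤP₀` by scalars `c'(σ)`. Then for some
primitive `p^k`-th root of unity `ζ ∈ K̄_E`, every `σ ∈ S` acts on `ζ` by `σζ = ζ^{c'(σ)c(σ)}`
(`det ρ = χ` on the ordinary filtration; with `c' = 1` on the layer-fixing elements this is the
cyclotomic line `σP₀ = cP₀ ⇒ σζ = ζ^c`, and for a Frobenius it gives `e b ≡ a`). (Weil pairing: `ζ = e_{p^k}(Q, P₀)` for `Q` with
`e(Q, P₀)` of exact order `p^k`, which exists by non-degeneracy since `p^{k-1}P₀ ≠ O`; then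
`σζ = e(σQ, σP₀) = e(c'Q + dP₀, cP₀) = ζ^{c'c} e(P₀, P₀)^{cd} = ζ^{c'c}`.) Silverman, *AEC*, III.8.1;
Cornell–Silverman–Stevens II §8 (`det ρ = χ`). [cite: SilvermanAEC2009, Prop. III.8.1] -/
theorem localPoints_exists_isPrimitiveRoot_smul_eq_pow {p : ℕ} [hp : Fact p.Prime] {k : ℕ}
    {P₀ : localPoints W E} (hP₀ : addOrderOf P₀ = p ^ k)
    (S : Set (absoluteGaloisGroup E)) (c c' : absoluteGaloisGroup E → ℕ)
    (h1 : ∀ σ ∈ S, σ • P₀ = c σ • P₀)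
    (h2 : ∀ σ ∈ S, ∀ Q : localPoints W E, ((p ^ k : ℕ) : ℤ) • Q = 0 →
      ∃ d : ℕ, σ • Q - c' σ • Q = d • P₀) :
    ∃ ζ : AlgebraicClosure E, IsPrimitiveRoot ζ (p ^ k) ∧
      ∀ σ ∈ S, σ • ζ = ζ ^ (c' σ * c σ) := by
  rcases Nat.eq_zero_or_pos k with rfl | hk
  · refine ⟨1, by rw [pow_zero]; exact IsPrimitiveRoot.one, fun σ hσ ↦ ?_⟩
    rw [smul_one, one_pow]
  -- the Weil pairing on `(W ⊗ E)[p^k]`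
  haveI : PerfectField E := PerfectField.ofCharZero
  have hm2 : 2 ≤ p ^ k := (hp.out.two_le.trans (Nat.le_self_pow hk.ne' p))
  have hmE : ((p ^ k : ℕ) : E) ≠ 0 := by exact_mod_cast pow_ne_zero k hp.out.ne_zero
  obtain ⟨e, hpow, haddl, haddr, hself, hnondeg, hgal⟩ :=
    exists_weilPairing_holds (W.baseChange E) (p ^ k) hm2 hmE
  -- transport `P₀` to the geometric points of `W ⊗ E`
  set T : localPoints W E ≃+ geomPoints (W.baseChange E) :=
    Affine.Point.congrEquiv (W.baseChange_baseChange_algebraicClosure_eq E).symm with hTdef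
  -- `T` is `Γ_E`-equivariant (both actions are on coordinates)
  have hT : ∀ (σ : absoluteGaloisGroup E) (P : localPoints W E), T (σ • P) = σ • T P := by
    intro σ P
    rcases P with _ | ⟨x, y, h⟩
    · change T (σ • (0 : localPoints W E)) = σ • T 0
      rw [smul_zero, map_zero, smul_zero]
    · rw [localPoints.smul_def, Affine.Point.map_some]
      refine (Affine.Point.congrEquiv_some _ _).trans ?_
      refine Eq.trans ?_ (congrArg (fun Q : geomPoints (W.baseChange E) ↦ σ • Q)
        (Affine.Point.congrEquiv_some (W.baseChange_baseChange_algebraicClosure_eq E).symm h)).symm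
      rfl
  have hP₀tor : ((p ^ k : ℕ) : ℤ) • (T P₀ : geomPoints (W.baseChange E)) = 0 := by
    rw [← map_zsmul, natCast_zsmul, ← hP₀, addOrderOf_nsmul_eq_zero, map_zero]
  set P₀' : geomTorsion (W.baseChange E) ((p ^ k : ℕ) : ℤ) :=
    ⟨T P₀, (mem_torsionPoints_iff _ _ _).mpr hP₀tor⟩ with hP₀'def
  -- elementary consequences of bilinearity
  have he0 : ∀ T', e 0 T' = 1 := fun T' ↦ by
    have h := haddl 0 0 T'
    rw [add_zero] at h
    have hne : e 0 T' ≠ 0 := fun h0 ↦ by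
      have := hpow 0 T'; rw [h0, zero_pow (pow_ne_zero k hp.out.ne_zero)] at this
      exact zero_ne_one this
    -- `x = x * x` with `x ≠ 0`
    exact (mul_right_eq_self₀.mp h.symm).resolve_right hne
  have hnsmul_left : ∀ (n : ℕ) (S' T' : geomTorsion (W.baseChange E) ((p ^ k : ℕ) : ℤ)),
      e (n • S') T' = e S' T' ^ n := by
    intro n S' T'
    induction n with
    | zero => rw [zero_smul, pow_zero, he0]
    | succ n ih => rw [add_smul, one_smul, haddl, ih, pow_succ]
  have he0r : ∀ S', e S' 0 = 1 := fun S' ↦ by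
    have h := haddr S' 0 0
    rw [add_zero] at h
    have hne : e S' 0 ≠ 0 := fun h0 ↦ by
      have := hpow S' 0; rw [h0, zero_pow (pow_ne_zero k hp.out.ne_zero)] at this
      exact zero_ne_one this
    exact (mul_right_eq_self₀.mp h.symm).resolve_right hne
  have hnsmul_right : ∀ (n : ℕ) (S' T' : geomTorsion (W.baseChange E) ((p ^ k : ℕ) : ℤ)),
      e S' (n • T') = e S' T' ^ n := by
    intro n S' T'
    induction n with
    | zero => rw [zero_smul, pow_zero, he0r]
    | succ n ih => rw [add_smul, one_smul, haddr, ih, pow_succ]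
  -- a partner `Q'` with `e(Q', P₀)` of exact order `p^k`
  obtain ⟨Q', hQ'⟩ : ∃ Q' : geomTorsion (W.baseChange E) ((p ^ k : ℕ) : ℤ),
      e Q' P₀' ^ p ^ (k - 1) ≠ 1 := by
    by_contra hall
    push Not at hall
    have h0 : (p ^ (k - 1)) • P₀' = 0 := by
      refine hnondeg _ fun S' ↦ ?_
      rw [hnsmul_right, hall]
    have h0' : (p ^ (k - 1)) • P₀ = 0 := by
      have h := congrArg (fun R : geomTorsion (W.baseChange E) ((p ^ k : ℕ) : ℤ) ↦
        (R : geomPoints (W.baseChange E))) h0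
      simp only [AddSubmonoidClass.coe_nsmul, ZeroMemClass.coe_zero] at h
      change (p ^ (k - 1)) • T P₀ = 0 at h
      rw [← map_nsmul, AddEquiv.map_eq_zero_iff] at h
      exact h
    have hdvd : p ^ k ∣ p ^ (k - 1) := by
      rw [← hP₀]; exact addOrderOf_dvd_of_nsmul_eq_zero h0'
    exact absurd (Nat.le_of_dvd (pow_pos hp.out.pos _) hdvd)
      (not_le.mpr (Nat.pow_lt_pow_right hp.out.one_lt (Nat.sub_lt hk one_pos)))
  set ζ := e Q' P₀' with hζdef
  have hζprim : IsPrimitiveRoot ζ (p ^ k) := by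
    have hζpow : ζ ^ p ^ k = 1 := hpow Q' P₀'
    have hdvd : orderOf ζ ∣ p ^ k := orderOf_dvd_of_pow_eq_one hζpow
    obtain ⟨i, hi, hci⟩ := (Nat.dvd_prime_pow hp.out).mp hdvd
    have hik : i = k := by
      by_contra hne
      have hlt : i ≤ k - 1 := Nat.le_sub_one_of_lt (lt_of_le_of_ne hi hne)
      apply hQ'
      have : orderOf ζ ∣ p ^ (k - 1) := hci ▸ pow_dvd_pow p hlt
      exact orderOf_dvd_iff_pow_eq_one.mp this
    have h := IsPrimitiveRoot.orderOf ζ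
    rwa [hci, hik] at h
  refine ⟨ζ, hζprim, fun σ hσ ↦ ?_⟩
  have hc := h1 σ hσ
  -- `σ • P₀' = c • P₀'` and `σ • Q' = c' • Q' + d • P₀'`
  have hσP₀ : σ • P₀' = c σ • P₀' := by
    apply Subtype.ext
    rw [AddSubgroup.torsionBy.coe_smul, AddSubmonoidClass.coe_nsmul]
    change σ • T P₀ = c σ • T P₀
    rw [← hT, hc, map_nsmul]
  obtain ⟨d, hd⟩ := h2 σ hσ (T.symm (Q' : geomPoints (W.baseChange E))) (by
    apply T.injective
    rw [map_zsmul, AddEquiv.apply_symm_apply, map_zero]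
    exact (mem_torsionPoints_iff _ _ _).mp Q'.2)
  have hσQ : σ • Q' = c' σ • Q' + d • P₀' := by
    apply Subtype.ext
    rw [AddSubgroup.torsionBy.coe_smul, AddSubgroup.coe_add, AddSubmonoidClass.coe_nsmul,
      AddSubmonoidClass.coe_nsmul]
    have h := congrArg T hd
    rw [map_sub, hT, AddEquiv.apply_symm_apply, map_nsmul, map_nsmul,
      AddEquiv.apply_symm_apply] at h
    change σ • (Q' : geomPoints (W.baseChange E)) - c' σ • (Q' : geomPoints (W.baseChange E)) =
      d • T P₀ at h
    rw [sub_eq_iff_eq_add'] at h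
    exact h
  -- `σ ζ = e(σQ', σP₀') = e(c'Q' + dP₀', cP₀') = ζ^{c' c}`
  rw [hζdef, hgal, hσQ, hσP₀, haddl, hnsmul_right, hnsmul_left, hnsmul_right, hnsmul_left, hself,
    one_pow, one_pow, mul_one, ← pow_mul]

end WeierstrassCurve
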